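import Mathlib
import Summits.ValiantsHypothesis.ValiantsHypothesis.Theorems.DivisionGapPerMultiplesHardSpreadPatternsRelD
import Summits.ValiantsHypothesis.ValiantsHypothesis.Theorems.DivisionGapPerMultiplesHardStubRelRegularCount
import Summits.ValiantsHypothesis.ValiantsHypothesis.Theorems.DivisionGapPerMultiplesHardStubSmallWindowArith
import Summits.ValiantsHypothesis.ValiantsHypothesis.Theorems.DivisionGapPerMultiplesHardStubEventuallyExp
import Summits.ValiantsHypothesis.ValiantsHypothesis.Theorems.DivisionGapPerMultiplesHardStubTwoBandTable
import Summits.ValiantsHypothesis.ValiantsHypothesis.Theorems.DivisionGapPerMultiplesHardRelDenseCompleteClass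
import Literature.Computability.AlgebraicComplexity.ArithCircuitProofs
import Literature.Computability.AlgebraicComplexity.PermanentIrreducible

/-!
# `DivisionGap.PerMultiplesHard` (stmt-ValiantsHypothesis-5068), line `uncharged-face-walk`:
the REGULAR-HOST complete-class rung — no mixing hypothesis

For the crux `PerMultiplesHard` (monotone exclusion complexity of the permanent) the line's
dense-host rung `RelDenseCompleteClass.relDenseCompleteClassHard` needed the shift intersection
`G ∩ ζG` of the host to be `(β, ε)`-upper-MIXING.  The small-window relative spread jaw of cycle 7
(`SpreadPatternsRelD.stub_spreadPatternsRelD` + `RelRegularCount.stub_relRegularCount` +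
`SmallWindowArith.stub_smallWindowArith`: typed window `n < 1024·Cf·#S ≤ 2n`, van der Waerden below,
Brégman–Minc above with the TRIVIAL degree bounds) removes that hypothesis entirely:

`relRegularCompleteClassHard`: for every `Cf ≥ 1` and all large `n`, if `G ⊆ [n]²` is a host whose
intersection with its `finRotate`-shift contains an `f`-REGULAR spanning subgraph `Y'` with
`n ≤ Cf · f`, and `t` is torus-homogeneous with balanced, `n`-close margins of offset `> n²` and
COMPLETE on `G` (every `G`-supported table with these margins is an exponent of `t`), then
`2^{⌊n/(1024 Cf²)⌋} ≤ L⁺(per_G · t)`.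

Instances (crux NOTES §I3): `G = K_{n,n}`; the circulant BAND hosts `{(i,j) : (i − j) mod n ∈ [0, w]}`,
`w ≥ n/Cf` (`Y'` = the shifts `[1, w]`), on which no σ-square block is quasi-random and the window-fifth
jaw is void; every host with a regular shift intersection of linear degree.

Proof: every permutation inside `Y'` carries a `finRotate`-spread probe in `supp (per_G · t)`
(`TwoBandTable.stub_twoBandTable` gives the 2-band table, its cells lie in `G` by the hypothesis on
`Y'`, completeness puts it in `supp t`, `RelDenseCompleteClass.probe_facePer_mul` lifts it); the
engine gives `16^k ≤ L² e^{2(Cf+1)} n^{Cf+1}` with `n < 1024·Cf·k`; `EventuallyExp.stub_eventuallyExp`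
absorbs the polynomial.  [cite: JerrumSnir1982, §3–4]
-/

noncomputable section

-- `Summit.ValiantsHypothesis.ValiantsHypothesis.…` is the tree's mandated layout (Sub = Summit).
set_option linter.dupNamespace false

namespace Summit.ValiantsHypothesis.ValiantsHypothesis.Theorems.DivisionGap.PerMultiplesHard.RelRegularCompleteClass

open MvPolynomial Literature.Computability.AlgebraicComplexity
open scoped NNReal BigOperators
open Summit.ValiantsHypothesis.ValiantsHypothesis.Theorems.DivisionGap.PerMultiplesHard

/-- **The small-window engine on a regular comparison host (full board).**  `g` torus-homogeneous on the `n`-board with nonzero rows, `Y'`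
`f`-regular (`f ≥ 1`, `n ≤ Cf·f`, `1024·Cf ≤ n`), every permutation inside `Y'` `finRotate n`-probed in `supp g`: then
`16^k ≤ L(g)² · e^{2(Cf+1)} · n^{Cf+1}` for some `k` with `n < 1024·Cf·k`. [folklore] -/
theorem smallWindowEngine {n Cf f : ℕ} (hn1 : 1 ≤ n) (hDn : 1024 * Cf ≤ n) (hCf : 1 ≤ Cf)
    (g : MvPolynomial (Fin n × Fin n) ℝ≥0) (ρ γ : Fin n → ℕ)
    (hg : ∀ m ∈ g.support, (∀ i, ∑ j, m (i, j) = ρ i) ∧ (∀ j, ∑ i, m (i, j) = γ j)) (hρ : ∀ i, ρ i ≠ 0)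
    (Y' : Finset (Fin n × Fin n)) (hf1 : 1 ≤ f) (hnf : n ≤ Cf * f)
    (hYrow : ∀ i : Fin n, (Finset.univ.filter fun j : Fin n => (i, j) ∈ Y').card = f)
    (hYcol : ∀ j : Fin n, (Finset.univ.filter fun i : Fin n => (i, j) ∈ Y').card = f)
    (hprobed : ∀ π : Equiv.Perm (Fin n), (∀ j, (π j, j) ∈ Y') →
      ∃ m ∈ g.support, ∀ e ∈ m.support, π e.2 = e.1 ∨ π e.2 = finRotate n e.1) :
    ∃ k : ℕ, n < 1024 * Cf * k ∧
      (16 : ℝ) ^ k ≤ ((complexity g : ℕ) : ℝ) ^ 2 * Real.exp (2 * ((Cf : ℝ) + 1)) * (n : ℝ) ^ (Cf + 1) := by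
  classical
  obtain ⟨S, T, hwin1, hwin2, hcap⟩ := SpreadPatternsRelD.stub_spreadPatternsRelD n (1024 * Cf) (by omega) hDn
    (finRotate n) g ρ γ hg hρ ((Finset.univ : Finset (Equiv.Perm (Fin n))).filter fun π => ∀ j, (π j, j) ∈ Y')
  have hall : ((Finset.univ : Finset (Equiv.Perm (Fin n))).filter (fun π => ∀ j, (π j, j) ∈ Y')).filter
      (fun π => ∃ m ∈ g.support, ∀ e ∈ m.support, π e.2 = e.1 ∨ π e.2 = finRotate n e.1) =
      (Finset.univ : Finset (Equiv.Perm (Fin n))).filter (fun π => ∀ j, (π j, j) ∈ Y') := by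
    refine Finset.filter_true_of_mem fun π hπ => ?_
    exact hprobed π (Finset.mem_filter.mp hπ).2
  rw [hall] at hcap
  obtain ⟨hST1, hST2, hineq⟩ :=
    RelRegularCount.stub_relRegularCount n Y' f hf1 hYrow hYcol (finRotate n) S T (complexity g) hcap
  have hfn : f ≤ n := by
    have := hYrow ⟨0, hn1⟩
    rw [← this]
    exact (Finset.card_filter_le _ _).trans (by simp)
  have hun : T.card ≤ n := (Finset.card_le_univ T).trans (by simp)
  exact ⟨S.card, hwin1, SmallWindowArith.stub_smallWindowArith n f S.card T.card (complexity g) Cf (1024 * Cf)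
    hn1 hf1 hfn hnf rfl hwin1 hwin2 hST1 hST2 hun hineq⟩

/-- **relRegularCompleteClassHard — the regular-host complete-class rung, NO mixing (lead c7, cycle 7).**  For every `Cf ≥ 1` there is `n₀`
such that for `n ≥ n₀`: if the host `G ⊆ [n]²` contains, TOGETHER WITH its `finRotate`-shift, an `f`-regular `Y'` (`(a, b) ∈ Y'` implies
`(a, b) ∈ G` and `((finRotate n)⁻¹ a, b) ∈ G`) with `1 ≤ f`, `n ≤ Cf·f`, and `t` is torus-homogeneous with margins `(R, C)`, COMPLETE on `G`,
balanced, `n`-close and of offset `> n²`, then `2^{⌊n/(1024·Cf²)⌋} ≤ L⁺(per_G · t)`. [cite: JerrumSnir1982, §3–4] -/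
theorem relRegularCompleteClassHard :
    ∀ Cf : ℕ, 1 ≤ Cf → ∃ n₀ : ℕ, ∀ n ≥ n₀, ∀ (G Y' : Finset (Fin n × Fin n)) (f : ℕ),
      (∀ e ∈ Y', e ∈ G ∧ ((finRotate n).symm e.1, e.2) ∈ G) → 1 ≤ f → n ≤ Cf * f →
      (∀ i : Fin n, (Finset.univ.filter fun j : Fin n => (i, j) ∈ Y').card = f) →
      (∀ j : Fin n, (Finset.univ.filter fun i : Fin n => (i, j) ∈ Y').card = f) →
      ∀ (t : MvPolynomial (Fin n × Fin n) ℝ≥0) (R C : Fin n → ℕ),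
        (∀ m ∈ t.support, (∀ i, ∑ j, m (i, j) = R i) ∧ (∀ j, ∑ i, m (i, j) = C j)) →
        (∀ M : (Fin n × Fin n) →₀ ℕ, M.support ⊆ G →
          (∀ i, ∑ j, M (i, j) = R i) → (∀ j, ∑ i, M (i, j) = C j) → M ∈ t.support) →
        ∑ i, R i = ∑ j, C j → (∀ i j, R i ≤ C j + n ∧ C j ≤ R i + n) → (∀ i, n ^ 2 + 1 ≤ R i) →
        2 ^ (n / (Cf * (1024 * Cf))) ≤
          complexity ((∑ σ ∈ (Finset.univ : Finset (Equiv.Perm (Fin n))).filter (fun σ => ∀ i, (σ i, i) ∈ G),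
            monomial (permMonomial σ) (1 : ℝ≥0)) * t) := by
  classical
  intro Cf hCf
  obtain ⟨n₂, hev⟩ := EventuallyExp.stub_eventuallyExp Cf (1024 * Cf) hCf (by omega)
  refine ⟨n₂ + 1024 * Cf + 1, ?_⟩
  intro n hn G Y' f hY' hf1 hnf hYrow hYcol t R C ht hcomp hbal hclose hoff
  have hn₂ : n₂ ≤ n := by omega
  have hn1 : 1 ≤ n := by omega
  have hDn : 1024 * Cf ≤ n := by omega
  -- probes
  have hprobed : ∀ π : Equiv.Perm (Fin n), (∀ j, (π j, j) ∈ Y') →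
      ∃ m ∈ ((∑ σ ∈ (Finset.univ : Finset (Equiv.Perm (Fin n))).filter (fun σ => ∀ i, (σ i, i) ∈ G),
        monomial (permMonomial σ) (1 : ℝ≥0)) * t).support,
        ∀ e ∈ m.support, π e.2 = e.1 ∨ π e.2 = finRotate n e.1 := by
    intro π hπ
    obtain ⟨M, hMband, hMR, hMC⟩ := TwoBandTable.stub_twoBandTable n π R C hbal hclose hoff
    have hMG : M.support ⊆ G := by
      intro e he
      rcases hMband e he with h | h
      · have := (hY' (π e.2, e.2) (hπ e.2)).1
        rw [h] at this; exact this
      · have := (hY' (π e.2, e.2) (hπ e.2)).2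
        have he1 : (finRotate n).symm (π e.2) = e.1 := by rw [h]; exact Equiv.symm_apply_apply _ _
        rw [he1] at this; exact this
    have hMt : M ∈ t.support := hcomp M hMG hMR hMC
    have hπG : ∀ i, (π i, i) ∈ G := fun i => (hY' (π i, i) (hπ i)).1
    exact RelDenseCompleteClass.probe_facePer_mul G π hπG hMt hMband
  -- the engine
  have hR0 : ∀ i, R i + 1 ≠ 0 := fun i => Nat.succ_ne_zero _
  obtain ⟨k, hk, h16⟩ := smallWindowEngine hn1 hDn hCf _ (fun i => R i + 1) (fun j => C j + 1)
    (RelDenseCompleteClass.margins_facePer_mul G ht) hR0 Y' hf1 hnf hYrow hYcol hprobed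
  set L₀ : ℕ := complexity ((∑ σ ∈ (Finset.univ : Finset (Equiv.Perm (Fin n))).filter (fun σ => ∀ i, (σ i, i) ∈ G),
      monomial (permMonomial σ) (1 : ℝ≥0)) * t) with hL₀
  have hmono : ((L₀ : ℕ) : ℝ) ^ 2 ≤ ((L₀ : ℝ) + 1) ^ 2 :=
    pow_le_pow_left₀ (Nat.cast_nonneg _) (by linarith) 2
  have hfinal : (16 : ℝ) ^ k ≤ ((L₀ : ℝ) + 1) ^ 2 * Real.exp (2 * ((Cf : ℝ) + 1)) * (n : ℝ) ^ (Cf + 1) := by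
    refine h16.trans ?_
    have hpos : 0 ≤ Real.exp (2 * ((Cf : ℝ) + 1)) * (n : ℝ) ^ (Cf + 1) := by positivity
    calc ((L₀ : ℕ) : ℝ) ^ 2 * Real.exp (2 * ((Cf : ℝ) + 1)) * (n : ℝ) ^ (Cf + 1)
        = ((L₀ : ℕ) : ℝ) ^ 2 * (Real.exp (2 * ((Cf : ℝ) + 1)) * (n : ℝ) ^ (Cf + 1)) := by ring
      _ ≤ ((L₀ : ℝ) + 1) ^ 2 * (Real.exp (2 * ((Cf : ℝ) + 1)) * (n : ℝ) ^ (Cf + 1)) :=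
          mul_le_mul_of_nonneg_right hmono hpos
      _ = _ := by ring
  have hnn : n ≤ Cf * n := Nat.le_mul_of_pos_left n hCf
  exact hev n hn₂ n k L₀ hnn le_rfl hk hfinal

end Summit.ValiantsHypothesis.ValiantsHypothesis.Theorems.DivisionGap.PerMultiplesHard.RelRegularCompleteClass

end
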